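import Summits.ValiantsHypothesis.ValiantsHypothesis.Theorems.KPlusLogSqLawTropicalBAffinePlane

/-!
# Route «KPlusLogSqLaw», crux `TropicalB` (stmt-ValiantsHypothesis-19771) — THE AFFINE-SKELETON LAW:
# static designs on `p` nodes whose dominant permutations are affine maps of `ZMod p` have `O(p^{3(K−1)/(K+1)})` chain terms

HONEST FRAMING.  Helper toward the registered stubs `stub_tropThin` / `stub_tropFat` of `Cruxes/TropicalB/Lines/birth.lean`
(crux `Summit.ValiantsHypothesis.ValiantsHypothesis.Theses.KPlusLogSqLaw.TropicalB`, item stmt-ValiantsHypothesis-19771, route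
KPlusLogSqLaw; cell `pub-symmetroid`, seat val-sym-trop-p4 g9, 2026-08-27; `--supports … --as helper`).  A NO-GO ROW OF THE
REGISTER CENSUS (architecture sector, like `…TropicalBGaugeSymmetry.gaugeCirculant_chain_succ_le` and `…TropicalBClassUniform`):
it bounds chains of STATIC designs (`TropicalCensus.IsStatic`) of size `p` (prime) all of whose dominant permutations are AFFINE
maps `b ↦ γ·b + δ` of `ZMod p` (through the natural bijection `Fin p → ZMod p`).  Nothing here bounds `TropicalB` for general
designs, and nothing bears on `WeakLifting`, DoorA26 / DoorA34, `MatrixDescartes` (stmt-ValiantsHypothesis-18050) or VP ≠ VNP.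

THE LAW (`affineSkeleton_law`).  For such a chain `q₀, …, qₙ` (strictly increasing integer slopes, every term dominant,
consecutive terms distinct) and every radius `t : ℕ`:

  `t² · (n + 1) ≤ p³ + t² · (2t + 1)^(K − 1)`.

Reading: with `t² ≈ (n+1)^{2/(K+1)}/8` this is `n + 1 = O((8p³)^{(K−1)/(K+1)})` — `O(p^{3/2})` at `K = 3` and `O(p^{9/5})` at
`K = 4`: SUB-QUADRATIC.  So the affine group of `ZMod p` (`p(p−1)` permutations on `p` points, every pair differing by at most two
non-trivial cycles) cannot host the cell's quadratic static `K = 3` capacity (`S(3m,3) ≥ C(m+2,2) − 1`, SHIFT-THREE through the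
port embedding, `…TropicalBStaticThree`), let alone a cubic `K = 4` family: two permutation registers are never both affine.
STATIC is essential: SHIFT-THREE itself uses only the rotations `b ↦ b + p` (affine, `γ = 1`) and has `C(m+2,2) − 1` terms — its
second digit is CLASS SWITCHING on fixed cells, which is exactly what a static design cannot do (port-embedding it destroys affinity).
PROOF.  Along the chain the slopes `Σ_b d(λ_k b)` strictly increase (`TropicalCensus.slope_lt_of_dominant`), so the class
histograms `H_k = (#{b : λ_k b = l})_l` are pairwise distinct, hence so are their truncations to `l < K − 1` (`Σ_l H_k l = p`).
For a static design the class of a present term at column `b` is THE class of the cell `(σ_k b, b)`, so `H_k l = |S_l ∩ L_k|` with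
`S_l` the class-`l` cells and `L_k` the graph line of the affine map `σ_k` in `(ZMod p)²`.  The distinct-histogram law for lines
(`AffinePlane.distinctHistograms_law`: two-point double count ⇒ variance identity `Σ_lines (p·|S ∩ L| − |S|)² = p|S|(p² − |S|)`,
plus integer packing) gives `t²·((n+1) − (2t+1)^{K−1}) ≤ p·Σ_{l<K−1} |S_l| ≤ p³`.
[folklore: second-moment method on the affine plane; this cell: the register-census reading]
-/

set_option linter.dupNamespace false
set_option autoImplicit false

namespace Summit.ValiantsHypothesis.ValiantsHypothesis.Theorems.KPlusLogSqLaw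

namespace AffineSkeleton

open Summit.ValiantsHypothesis.ValiantsHypothesis.Theorems.MatrixDescartes.Negative
open Summit.ValiantsHypothesis.ValiantsHypothesis.Theorems.LacunarySymmetroidMatrixDescartes
open Summit.ValiantsHypothesis.ValiantsHypothesis.Theorems.LacunarySymmetroidMatrixDescartes.TropicalCensus
open AffinePlane Finset

section Casts

variable {p : ℕ} [Fact p.Prime]

/-- the natural map `Fin p → ZMod p`, `b ↦ (b : ℕ)`, is injective. [folklore] -/
theorem natCast_fin_injective : Function.Injective fun b : Fin p => ((b : ℕ) : ZMod p) := by
  intro a b h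
  have ha : (((a : ℕ) : ZMod p)).val = (a : ℕ) := ZMod.val_cast_of_lt a.isLt
  have hb : (((b : ℕ) : ZMod p)).val = (b : ℕ) := ZMod.val_cast_of_lt b.isLt
  apply Fin.ext
  have := congrArg ZMod.val h
  simp only at this
  rw [ha, hb] at this
  exact this

/-- the cell map `Fin p × Fin p → ZMod p × ZMod p` is injective. [folklore] -/
theorem cellCast_injective :
    Function.Injective fun ab : Fin p × Fin p => (((ab.1 : ℕ) : ZMod p), ((ab.2 : ℕ) : ZMod p)) := by
  intro x y h
  simp only [Prod.mk.injEq] at h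
  exact Prod.ext (natCast_fin_injective h.1) (natCast_fin_injective h.2)

end Casts

section Histogram

variable {m K : ℕ}

/-- the slope of a term is the `d`-weighted sum of its class histogram: `Σ_b d(λ b) = Σ_l d l · #{b : λ b = l}`. [folklore] -/
theorem slope_eq_sum_hist (d : Fin K → ℕ) (q : Equiv.Perm (Fin m) × (Fin m → Fin K)) :
    TropicalCensus.slope d q = ∑ l, (d l : ℤ) * ((univ.filter fun b : Fin m => q.2 b = l).card : ℤ) := by
  unfold TropicalCensus.slope
  have h1 : ∀ b : Fin m, (d (q.2 b) : ℤ) = ∑ l, if q.2 b = l then (d l : ℤ) else 0 := by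
    intro b
    rw [Finset.sum_ite_eq univ (q.2 b) (fun l => (d l : ℤ))]
    simp
  simp_rw [h1]
  rw [Finset.sum_comm]
  refine Finset.sum_congr rfl fun l _ => ?_
  rw [← Finset.sum_filter, Finset.sum_const, nsmul_eq_mul, mul_comm]

/-- the class histogram of a term sums to `m`. [folklore] -/
theorem sum_hist (q : Equiv.Perm (Fin m) × (Fin m → Fin K)) :
    ∑ l, ((univ.filter fun b : Fin m => q.2 b = l).card : ℤ) = m := by
  have h := Finset.card_eq_sum_card_fiberwise (s := (univ : Finset (Fin m))) (t := (univ : Finset (Fin K)))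
    (f := q.2) (fun b _ => mem_univ _)
  rw [card_univ, Fintype.card_fin] at h
  have : ((∑ l : Fin K, (univ.filter fun b : Fin m => q.2 b = l).card : ℕ) : ℤ) = (m : ℤ) := by rw [← h]
  push_cast at this
  exact this

end Histogram

section Law

variable {p K : ℕ} [Fact p.Prime]

/-- class-`l` cells of the design, transported to `(ZMod p)²`. -/
theorem mem_cells_iff (ε : Fin p → Fin p → Fin K → ℤ) (l : Fin K) (x : ZMod p × ZMod p) :
    x ∈ (univ.filter fun ab : Fin p × Fin p => ε ab.1 ab.2 l ≠ 0).image
        (fun ab : Fin p × Fin p => (((ab.1 : ℕ) : ZMod p), ((ab.2 : ℕ) : ZMod p))) ↔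
      ∃ a b : Fin p, ε a b l ≠ 0 ∧ x = (((a : ℕ) : ZMod p), ((b : ℕ) : ZMod p)) := by
  rw [Finset.mem_image]
  constructor
  · rintro ⟨⟨a, b⟩, hab, rfl⟩
    exact ⟨a, b, (Finset.mem_filter.mp hab).2, rfl⟩
  · rintro ⟨a, b, hab, rfl⟩
    exact ⟨(a, b), Finset.mem_filter.mpr ⟨mem_univ _, hab⟩, rfl⟩

/-- **histogram = line sum.**  For a present term of a STATIC design whose permutation is the affine map `b ↦ γ b + δ`, the number
of columns of class `l` is the number of class-`l` cells on the graph line `inl (γ, δ)`. [this cell] -/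
theorem hist_eq_lineCount (ε : Fin p → Fin p → Fin K → ℤ) (hstat : IsStatic ε)
    (q : Equiv.Perm (Fin p) × (Fin p → Fin K)) (hq : termSign ε q ≠ 0) (γ δ : ZMod p)
    (haff : ∀ b : Fin p, (((q.1 b : ℕ)) : ZMod p) = γ * ((b : ℕ) : ZMod p) + δ) (l : Fin K) :
    (univ.filter fun b : Fin p => q.2 b = l).card =
      (((univ.filter fun ab : Fin p × Fin p => ε ab.1 ab.2 l ≠ 0).image
        (fun ab : Fin p × Fin p => (((ab.1 : ℕ) : ZMod p), ((ab.2 : ℕ) : ZMod p)))).filter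
          fun x => x ∈ line p (Sum.inl (γ, δ))).card := by
  have hp : 0 < p := (Fact.out : p.Prime).pos
  -- the column of a (transported) cell
  have hbval : ∀ b : Fin p, (⟨ZMod.val (((b : ℕ) : ZMod p)) % p, Nat.mod_lt _ hp⟩ : Fin p) = b := by
    intro b
    apply Fin.ext
    simp only
    rw [ZMod.val_cast_of_lt b.isLt, Nat.mod_eq_of_lt b.isLt]
  refine Finset.card_bij' (fun b _ => ((((q.1 b : ℕ)) : ZMod p), (((b : ℕ) : ZMod p))))
    (fun x _ => (⟨ZMod.val x.2 % p, Nat.mod_lt _ hp⟩ : Fin p)) ?_ ?_ ?_ ?_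
  · -- the cell of a class-`l` column is a class-`l` cell on the line
    intro b hb
    rw [Finset.mem_filter] at hb
    rw [Finset.mem_filter, mem_cells_iff, mem_line_inl]
    refine ⟨⟨q.1 b, b, ?_, rfl⟩, ?_⟩
    · have hpres : ε (q.1 b) b (q.2 b) ≠ 0 := present_of_termSign_ne_zero ε q hq b
      rw [hb.2] at hpres
      exact hpres
    · exact haff b
  · -- the column of a class-`l` cell on the line has class `l`
    intro x hx
    rw [Finset.mem_filter] at hx
    obtain ⟨hS, hL⟩ := hx
    rw [mem_cells_iff] at hS
    obtain ⟨a, b, hab, rfl⟩ := hS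
    rw [mem_line_inl] at hL
    rw [Finset.mem_filter]
    refine ⟨mem_univ _, ?_⟩
    rw [hbval b]
    -- `σ b = a` by injectivity of the cast, then staticity
    have hσ : q.1 b = a := by
      apply natCast_fin_injective
      simp only
      rw [haff b]
      exact hL.symm
    have hpres : ε (q.1 b) b (q.2 b) ≠ 0 := present_of_termSign_ne_zero ε q hq b
    rw [hσ] at hpres
    exact hstat a b (q.2 b) l hpres hab
  · -- column ↦ cell ↦ column
    intro b _
    exact hbval b
  · -- cell ↦ column ↦ cell
    intro x hx
    rw [Finset.mem_filter] at hx
    obtain ⟨hS, hL⟩ := hx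
    rw [mem_cells_iff] at hS
    obtain ⟨a, b, hab, rfl⟩ := hS
    rw [mem_line_inl] at hL
    simp only at hL
    rw [hbval b]
    apply Prod.ext
    · simp only
      rw [haff b]
      exact hL.symm
    · rfl

/-- the class cell sets of a static design have total size at most `p²`. [folklore] -/
theorem sum_card_cells_le (ε : Fin p → Fin p → Fin K → ℤ) (hstat : IsStatic ε) (s : Finset (Fin K)) :
    ∑ l ∈ s, ((((univ.filter fun ab : Fin p × Fin p => ε ab.1 ab.2 l ≠ 0).image
        (fun ab : Fin p × Fin p => (((ab.1 : ℕ) : ZMod p), ((ab.2 : ℕ) : ZMod p)))).card : ℕ) : ℤ) ≤ (p : ℤ) ^ 2 := by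
  have hcard : ∀ l, ((univ.filter fun ab : Fin p × Fin p => ε ab.1 ab.2 l ≠ 0).image
      (fun ab : Fin p × Fin p => (((ab.1 : ℕ) : ZMod p), ((ab.2 : ℕ) : ZMod p)))).card =
        (univ.filter fun ab : Fin p × Fin p => ε ab.1 ab.2 l ≠ 0).card :=
    fun l => Finset.card_image_of_injective _ cellCast_injective
  simp_rw [hcard]
  have hdisj : (s : Set (Fin K)).PairwiseDisjoint fun l => univ.filter fun ab : Fin p × Fin p => ε ab.1 ab.2 l ≠ 0 := by
    intro l _ l' _ hll'
    rw [Function.onFun, Finset.disjoint_left]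
    intro ab h1 h2
    rw [Finset.mem_filter] at h1 h2
    exact hll' (hstat ab.1 ab.2 l l' h1.2 h2.2)
  have h := Finset.card_biUnion hdisj
  have hle : (s.biUnion fun l => univ.filter fun ab : Fin p × Fin p => ε ab.1 ab.2 l ≠ 0).card ≤
      (univ : Finset (Fin p × Fin p)).card := Finset.card_le_card (Finset.subset_univ _)
  rw [h, card_univ, Fintype.card_prod, Fintype.card_fin] at hle
  have : ((∑ l ∈ s, (univ.filter fun ab : Fin p × Fin p => ε ab.1 ab.2 l ≠ 0).card : ℕ) : ℤ) ≤ ((p * p : ℕ) : ℤ) := by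
    exact_mod_cast hle
  push_cast at this
  linarith [this]

/-- **THE AFFINE-SKELETON LAW FOR TERM FAMILIES** (integer form).  A static design of prime size `p` with `K` classes and ANY
finite family `q : ι → terms` of PRESENT terms with pairwise distinct slopes whose permutations are all affine
(`σ_i b ≡ γ_i·b + δ_i (mod p)`): for every `t : ℕ`, `t²·(|ι| − (2t+1)^(K−1)) ≤ p³`.  (Chains of dominant terms are the case
`ι = Fin (n+1)`, below; the family form also covers e.g. the set of all terms dominant at some real slope.) [this cell] -/
theorem affineTerms_law_int {ι : Type*} [Fintype ι] (d : Fin K → ℕ) (ε : Fin p → Fin p → Fin K → ℤ) (hstat : IsStatic ε)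
    (q : ι → Equiv.Perm (Fin p) × (Fin p → Fin K)) (hpres : ∀ i, termSign ε (q i) ≠ 0)
    (hslope : Function.Injective fun i => TropicalCensus.slope d (q i))
    (haff : ∀ i, ∃ γ δ : ZMod p, ∀ b : Fin p, (((q i).1 b : ℕ) : ZMod p) = γ * ((b : ℕ) : ZMod p) + δ)
    (t : ℕ) :
    (t : ℤ) ^ 2 * ((Fintype.card ι : ℤ) - (2 * t + 1) ^ (K - 1)) ≤ (p : ℤ) ^ 3 := by
  classical
  -- `K = 0`: no terms at all (`p ≥ 2` columns need a class), so `|ι| = 0`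
  rcases Nat.eq_zero_or_pos K with hK | hK
  · subst hK
    have hp : 0 < p := (Fact.out : p.Prime).pos
    have hι : Fintype.card ι = 0 := by
      rw [Fintype.card_eq_zero_iff]
      exact ⟨fun i => ((q i).2 ⟨0, hp⟩).elim0⟩
    rw [hι]
    push_cast
    have h1 : (1 : ℤ) ≤ (2 * t + 1) ^ (0 - 1) := one_le_pow₀ (by omega)
    have hp3 : (0 : ℤ) ≤ (p : ℤ) ^ 3 := by positivity
    nlinarith [sq_nonneg (t : ℤ), mul_nonneg (sq_nonneg (t : ℤ)) (sub_nonneg.mpr h1)]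
  obtain ⟨K', rfl⟩ : ∃ K', K = K' + 1 := ⟨K - 1, by omega⟩
  simp only [Nat.add_sub_cancel]
  -- affine parameters and lines
  choose γ δ hγδ using haff
  set f : ι → (ZMod p × ZMod p) ⊕ ZMod p := fun k => Sum.inl (γ k, δ k) with hf
  -- cell sets of the first `K'` classes
  set S : Fin K' → Finset (ZMod p × ZMod p) := fun l =>
    (univ.filter fun ab : Fin p × Fin p => ε ab.1 ab.2 (Fin.castSucc l) ≠ 0).image
      (fun ab : Fin p × Fin p => (((ab.1 : ℕ) : ZMod p), ((ab.2 : ℕ) : ZMod p))) with hS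
  -- histograms
  set H : ι → Fin (K' + 1) → ℤ := fun k l => ((univ.filter fun b : Fin p => (q k).2 b = l).card : ℤ) with hH
  -- (1) distinct slopes ⇒ full histograms injective
  have hHinj : Function.Injective H := by
    intro j k hjk
    apply hslope
    simp only
    rw [slope_eq_sum_hist, slope_eq_sum_hist]
    refine Finset.sum_congr rfl fun l _ => ?_
    have := congrFun hjk l
    simp only [hH] at this
    rw [this]
  -- (2) truncated histograms are injective (`Σ_l H k l = p`)
  have htrunc : Function.Injective fun k => fun l : Fin K' => H k (Fin.castSucc l) := by
    intro j k hjk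
    apply hHinj
    funext l
    rcases Fin.eq_castSucc_or_eq_last l with ⟨l', rfl⟩ | rfl
    · exact congrFun hjk l'
    · have hj := sum_hist (q j)
      have hk := sum_hist (q k)
      rw [Fin.sum_univ_castSucc] at hj hk
      have e : ∑ l : Fin K', H j (Fin.castSucc l) = ∑ l : Fin K', H k (Fin.castSucc l) :=
        Finset.sum_congr rfl fun l _ => congrFun hjk l
      simp only [hH] at e ⊢
      linarith
  -- (3) histograms are line sums
  have hline : ∀ k (l : Fin K'), H k (Fin.castSucc l) = (((S l).filter fun x => x ∈ line p (f k)).card : ℤ) := by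
    intro k l
    simp only [hH, hS, hf]
    exact_mod_cast hist_eq_lineCount ε hstat (q k) (hpres k) (γ k) (δ k) (hγδ k) (Fin.castSucc l)
  -- (4) the family of lines and injectivity of the line-histogram on it
  set A : Finset ((ZMod p × ZMod p) ⊕ ZMod p) := univ.image f with hA
  have hG : Set.InjOn (fun ℓ => fun l : Fin K' => (((S l).filter fun x => x ∈ line p ℓ).card : ℤ)) A := by
    intro ℓ hℓ ℓ' hℓ' e
    rw [hA, Finset.coe_image] at hℓ hℓ'
    obtain ⟨j, -, rfl⟩ := hℓ
    obtain ⟨k, -, rfl⟩ := hℓ'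
    have : j = k := by
      apply htrunc
      funext l
      simp only
      rw [hline j l, hline k l]
      exact congrFun e l
    rw [this]
  have hfinj : Function.Injective f := by
    intro j k e
    apply htrunc
    funext l
    simp only
    rw [hline j l, hline k l, e]
  have hAcard : A.card = Fintype.card ι := by
    rw [hA, Finset.card_image_of_injective _ hfinj, card_univ]
  -- (5) the distinct-histogram law for lines, and the cell budget
  have hlaw := distinctHistograms_law p S A hG t
  rw [hAcard] at hlaw
  have hbudget : (p : ℤ) * ∑ l, ((S l).card : ℤ) ≤ (p : ℤ) ^ 3 := by
    have h1 : ∑ l : Fin K', ((S l).card : ℤ) ≤ (p : ℤ) ^ 2 := by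
      have himg := sum_card_cells_le ε hstat ((univ : Finset (Fin K')).image Fin.castSucc)
      rw [Finset.sum_image (fun a _ b _ h => Fin.castSucc_injective _ h)] at himg
      simpa only [hS] using himg
    have hp : (0 : ℤ) ≤ p := by positivity
    nlinarith
  linarith

/-- **THE AFFINE-SKELETON LAW** (chains, integer form).  A static design of prime size `p` with `K` classes; a chain `q₀, …, qₙ`
of terms dominant at strictly increasing integer slopes, consecutive terms distinct, EVERY permutation affine
(`σ_k b ≡ γ_k·b + δ_k (mod p)`).  Then for every `t : ℕ`:  `t²·((n+1) − (2t+1)^(K−1)) ≤ p³`. [this cell] -/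
theorem affineSkeleton_law_int (d : Fin K → ℕ) (v ε : Fin p → Fin p → Fin K → ℤ) (hstat : IsStatic ε)
    {n : ℕ} (θ : Fin (n + 1) → ℤ) (q : Fin (n + 1) → Equiv.Perm (Fin p) × (Fin p → Fin K))
    (hθ : StrictMono θ) (hdom : ∀ k, IsDominant d v ε (θ k) (q k))
    (hne : ∀ k : Fin n, q k.castSucc ≠ q k.succ)
    (haff : ∀ k, ∃ γ δ : ZMod p, ∀ b : Fin p, (((q k).1 b : ℕ) : ZMod p) = γ * ((b : ℕ) : ZMod p) + δ)
    (t : ℕ) :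
    (t : ℤ) ^ 2 * ((n + 1 : ℤ) - (2 * t + 1) ^ (K - 1)) ≤ (p : ℤ) ^ 3 := by
  have hsm : StrictMono fun k => TropicalCensus.slope d (q k) := by
    rw [Fin.strictMono_iff_lt_succ]
    intro k
    exact slope_lt_of_dominant d v ε (hθ Fin.castSucc_lt_succ) (hne k) (hdom _) (hdom _)
  have h := affineTerms_law_int d ε hstat q (fun k => (hdom k).1) hsm.injective haff t
  rw [Fintype.card_fin] at h
  push_cast at h
  exact h

/-- **THE AFFINE-SKELETON LAW** (natural-number form): `t²·(n+1) ≤ p³ + t²·(2t+1)^(K−1)` for every `t`.  With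
`t² ≈ (n+1)^{2/(K+1)}/8`: `n + 1 = O((8p³)^{(K−1)/(K+1)})` — `O(p^{3/2})` at `K = 3`, `O(p^{9/5})` at `K = 4`: static chains on affine
skeletons are SUB-QUADRATIC for `K ≤ 4`. [this cell] -/
theorem affineSkeleton_law (d : Fin K → ℕ) (v ε : Fin p → Fin p → Fin K → ℤ) (hstat : IsStatic ε)
    {n : ℕ} (θ : Fin (n + 1) → ℤ) (q : Fin (n + 1) → Equiv.Perm (Fin p) × (Fin p → Fin K))
    (hθ : StrictMono θ) (hdom : ∀ k, IsDominant d v ε (θ k) (q k))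
    (hne : ∀ k : Fin n, q k.castSucc ≠ q k.succ)
    (haff : ∀ k, ∃ γ δ : ZMod p, ∀ b : Fin p, (((q k).1 b : ℕ) : ZMod p) = γ * ((b : ℕ) : ZMod p) + δ)
    (t : ℕ) :
    t ^ 2 * (n + 1) ≤ p ^ 3 + t ^ 2 * (2 * t + 1) ^ (K - 1) := by
  have h := affineSkeleton_law_int d v ε hstat θ q hθ hdom hne haff t
  have : ((t ^ 2 * (n + 1) : ℕ) : ℤ) ≤ ((p ^ 3 + t ^ 2 * (2 * t + 1) ^ (K - 1) : ℕ) : ℤ) := by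
    push_cast
    linarith
  exact_mod_cast this

/-- the same for SIGN-ALTERNATING chains (the crux's hypotheses): consecutive terms are then distinct. [this cell] -/
theorem affineSkeleton_law_signed (d : Fin K → ℕ) (v ε : Fin p → Fin p → Fin K → ℤ) (hstat : IsStatic ε)
    {n : ℕ} (θ : Fin (n + 1) → ℤ) (q : Fin (n + 1) → Equiv.Perm (Fin p) × (Fin p → Fin K))
    (hθ : StrictMono θ) (hdom : ∀ k, IsDominant d v ε (θ k) (q k))
    (halt : ∀ k : Fin n, termSign ε (q k.castSucc) * termSign ε (q k.succ) < 0)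
    (haff : ∀ k, ∃ γ δ : ZMod p, ∀ b : Fin p, (((q k).1 b : ℕ) : ZMod p) = γ * ((b : ℕ) : ZMod p) + δ)
    (t : ℕ) :
    t ^ 2 * (n + 1) ≤ p ^ 3 + t ^ 2 * (2 * t + 1) ^ (K - 1) := by
  refine affineSkeleton_law d v ε hstat θ q hθ hdom ?_ haff t
  intro k h
  have := halt k
  rw [h] at this
  exact absurd this (not_lt.mpr (mul_self_nonneg _))

/-- **`K = 3` (two-register format), closed form**: `(n + 1)² ≤ 128·p³ + 4096` — at most `≈ 11.4·p^{3/2}` chain terms on an affine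
skeleton, against `≈ M²/18` for the static SHIFT-THREE family (rotations + ports). [this cell] -/
theorem affineSkeleton_three (d : Fin 3 → ℕ) (v ε : Fin p → Fin p → Fin 3 → ℤ) (hstat : IsStatic ε)
    {n : ℕ} (θ : Fin (n + 1) → ℤ) (q : Fin (n + 1) → Equiv.Perm (Fin p) × (Fin p → Fin 3))
    (hθ : StrictMono θ) (hdom : ∀ k, IsDominant d v ε (θ k) (q k))
    (hne : ∀ k : Fin n, q k.castSucc ≠ q k.succ)
    (haff : ∀ k, ∃ γ δ : ZMod p, ∀ b : Fin p, (((q k).1 b : ℕ) : ZMod p) = γ * ((b : ℕ) : ZMod p) + δ) :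
    (n + 1) ^ 2 ≤ 128 * p ^ 3 + 4096 := by
  have h := fun t => affineSkeleton_law_int d v ε hstat θ q hθ hdom hne haff t
  have h' : ∀ t : ℕ, (t : ℤ) ^ 2 * (((n + 1 : ℕ) : ℤ) - (2 * t + 1) ^ 2) ≤ (p : ℤ) ^ 3 := by
    intro t
    have := h t
    push_cast at this ⊢
    exact this
  have := sq_le_of_law_two (n + 1) ((p : ℤ) ^ 3) h'
  have e : (((n + 1) ^ 2 : ℕ) : ℤ) ≤ ((128 * p ^ 3 + 4096 : ℕ) : ℤ) := by push_cast at this ⊢; linarith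
  exact_mod_cast e

end Law

end AffineSkeleton

end Summit.ValiantsHypothesis.ValiantsHypothesis.Theorems.KPlusLogSqLaw

/-! ### Erratum to the module docstring (appended 2026-08-27, same seat)
The parenthetical «every pair differing by at most two non-trivial cycles» about the affine group of `ZMod p` is true only when
`(p − 1)/2` is prime and the two multipliers differ by an element of order `≥ (p−1)/2`; in general the quotient `x ↦ γx + δ` of two
affine maps has one fixed point and `(p − 1)/ord γ` cycles of length `ord γ` (for `γ ≠ 1`), resp. is one `p`-cycle (for `γ = 1`,
`δ ≠ 0`).  Nothing in the statements or proofs of this file uses the parenthetical. -/
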